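import Summits.ResolutionOfSingularities.ResolutionOfSingularities.Theorems.EquisingularLiftEquisingularLiftNatCarrierDeltaComapFrame
import Literature.AlgebraicGeometry.Resolution.StalkIdealLemmas
import Mathlib.RingTheory.Flat.TorsionFree
import Mathlib.AlgebraicGeometry.Morphisms.Flat
import HarnessLib

/-!
# [OURS · L1 W4.5(b) · EL♮(3)] S6 (a)/(c) — THE CENTRE'S 2-FRAMES DESCEND TO THE SPECIAL FIBRE: R3 (`I` has quasi-regular 2-frames,
# `V(I) → Spec O` flat) ⇒ DIRDICT (a)'s `hfr` («`Ī = I·𝒪_{G₀} = 𝓘⟨Z₀⟩` has quasi-regular 2-frames at every point of `Z₀`»)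

Crux chain w45b (cell `res-hironaka`, slot W4.5(b)), working crux **EL♮** = stmt-ResolutionOfSingularities-20038, child **EL♮(3)** =
stmt-ResolutionOfSingularities-20148, route EquisingularLift, line `sections`; rung TOWER₃ (and DIR₀₁), stand-in S6 `hCech` → (N1) `hCentre`
(res-D-pv-057's `Tower.inv₂_cechRound_new` p568199; assembly `Tower.hCentre_of`, 057). Written by res-L1-w45b-stub-2 g7 (STATUS 21:1xZ):
the input `hfr` of res-D-pv-051's DIRDICT (a) `exists_direction_of_section` (p559974) at the ROOT of `DirLift.Ruled`, read off R2 (model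
square `j₀`, reduced trace `I·𝒪_{G₀} = 𝓘⟨Z₀⟩`) and R3 (flatness of `V(I) → Spec O`, quasi-regular 2-frames of `I` on `supp I`). HONEST
FRAMING: OURS; NOT a statement of any manuscript; AI-written, weaker than expert review. No `sorry`; standard axioms. DEF-FREE.
`--supports stmt-ResolutionOfSingularities-20148 --as helper`.

WHAT (namespace `…Cruxes.EquisingularLiftNat.Sections`).
* `forall_mul_mem_stalkIdeal_of_flat` — **flatness of `V(I) → Spec O` makes the uniformiser a nonzerodivisor modulo `I_x`**: for
  `x ∈ supp I` and `ϖ ∈ O ∖ 0`, `ϖ_x · y ∈ I_x ⇒ y ∈ I_x` (`𝒪_{V(I),x} = 𝒪_{X,x}/I_x` is flat over the localisation of the domain `O`;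
  Mathlib `Module.Flat.isSMulRegular_of_nonZeroDivisors`).
* **`forall_exists_twoFrame_specialFibre_of_flat`** — in a model square `j : F ⟶ X` over `θ : O ↠ k` (`O` a DVR): if `I` has
  quasi-regular 2-frames at the points of `supp I`, `V(I) → Spec O` is flat and `I·𝒪_F = 𝓘⟨Z⟩`, then `𝓘⟨Z⟩` has quasi-regular 2-frames
  at every `z ∈ Z` — the images `j♯_z ∘ c` (res-L1-w45b-stub-2's `IsQuasiRegular.comp_of_surjective`, Matsumura 16.2 (ii), with the
  model-square facts `stalkMap_model_surjective` / `stalkMap_model_varpi` / `ker_stalkMap_model_le` of …NatCarrierDeltaComapFrame).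

References (index only): Matsumura, Thm. 16.2 (ii) and §7 (flat ⇒ torsion-free over a domain). [cite: Matsumura1987, Thm. 16.2]
-/

set_option linter.dupNamespace false -- mandated namespace `Summit.<Summit>.<Problem>` of this single-conjunct summit
set_option linter.overlappingInstances false -- the binders carry `[IsDomain O] [IsDiscreteValuationRing O]`

noncomputable section

open CategoryTheory CategoryTheory.Limits AlgebraicGeometry TopologicalSpace Topology IsLocalRing
open Literature.AlgebraicGeometry.Resolution
open AlgebraicGeometry.Scheme.IdealSheafData
open Summit.ResolutionOfSingularities.ResolutionOfSingularities.Cruxes.EquisingularLift.StrataSplit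

namespace Summit.ResolutionOfSingularities.ResolutionOfSingularities.Cruxes.EquisingularLiftNat.Sections

/-- **Flatness of `V(I) → Spec O` makes a nonzero scalar a nonzerodivisor modulo `I_x`.** [cite: Matsumura1987, Thm. 7.7 / §16] -/
theorem forall_mul_mem_stalkIdeal_of_flat {O : Type} [CommRing O] [IsDomain O] {X : Scheme.{0}} (r : X ⟶ Spec (.of O))
    (I : X.IdealSheafData) (hflat : Flat (I.subschemeι ≫ r)) (x : X) (hx : x ∈ I.support) (ϖ : O) (hϖ0 : ϖ ≠ 0) :
    ∀ y : X.presheaf.stalk x,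
      (X.presheaf.Γgerm x).hom (r.appTop.hom ((Scheme.ΓSpecIso (.of O)).inv.hom ϖ)) * y ∈ stalkIdeal I x → y ∈ stalkIdeal I x := by
  classical
  -- the point `ŵ` of `V(I)` over `x` and `ψ : 𝒪_{X,x} ↠ 𝒪_{V(I),ŵ}` with kernel `I_x`
  have hx' : x ∈ Set.range I.subschemeι := by rw [Scheme.IdealSheafData.range_subschemeι]; exact hx
  obtain ⟨ŵ, rfl⟩ := hx'
  set ψ : (X.presheaf.stalk (I.subschemeι ŵ) : Type) →+* (I.subscheme.presheaf.stalk ŵ : Type) :=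
    (I.subschemeι.stalkMap ŵ).hom with hψ
  have hψker : RingHom.ker ψ = stalkIdeal I (I.subschemeι ŵ) := by
    rw [hψ, ← stalkIdeal_ker_eq_ker_stalkMap, Scheme.IdealSheafData.ker_subschemeι]
  -- the germ `ϖs` of `ϖ` on `Spec O` is a nonzerodivisor (localisation of a domain)
  set ϖΓ : Γ(Spec (.of O), ⊤) := (Scheme.ΓSpecIso (.of O)).inv ϖ with hϖΓ
  set ϖs : (Spec (.of O)).presheaf.stalk (r (I.subschemeι ŵ)) :=
    (Spec (CommRingCat.of O)).presheaf.germ ⊤ (r (I.subschemeι ŵ)) trivial ϖΓ with hϖs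
  have hϖs_reg : ϖs ∈ nonZeroDivisors ((Spec (.of O)).presheaf.stalk (r (I.subschemeι ŵ))) := by
    letI : Algebra Γ(Spec (.of O), ⊤) ((Spec (CommRingCat.of O)).presheaf.stalk (r (I.subschemeι ŵ))) :=
      ((Spec (CommRingCat.of O)).presheaf.germ ⊤ (r (I.subschemeι ŵ)) trivial).hom.toAlgebra
    haveI := (isAffineOpen_top (Spec (.of O))).isLocalization_stalk ⟨r (I.subschemeι ŵ), trivial⟩
    have hϖΓreg : ϖΓ ∈ nonZeroDivisors Γ(Spec (.of O), ⊤) := by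
      refine mem_nonZeroDivisors_of_ne_zero ?_
      rw [hϖΓ]
      intro h0
      apply hϖ0
      have := congrArg (Scheme.ΓSpecIso (.of O)).hom h0
      simpa using this
    exact map_mem_nonZeroDivisors_of_isLocalization
      (((isAffineOpen_top (Spec (.of O))).primeIdealOf ⟨r (I.subschemeι ŵ), trivial⟩).asIdeal.primeCompl) _ hϖΓreg
  -- flatness: `ψ (ϖ_x)` is a nonzerodivisor of `𝒪_{V(I),ŵ}`
  have hϖA : (r.stalkMap (I.subschemeι ŵ)).hom ϖs =
      (X.presheaf.Γgerm (I.subschemeι ŵ)).hom (r.appTop.hom ((Scheme.ΓSpecIso (.of O)).inv.hom ϖ)) := by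
    rw [← stalkMap_Γgerm_apply']; rfl
  have hcomp : ((I.subschemeι ≫ r).stalkMap ŵ).hom ϖs =
      ψ ((X.presheaf.Γgerm (I.subschemeι ŵ)).hom (r.appTop.hom ((Scheme.ΓSpecIso (.of O)).inv.hom ϖ))) := by
    rw [← hϖA, Scheme.Hom.stalkMap_comp]; rfl
  have hψϖ : ψ ((X.presheaf.Γgerm (I.subschemeι ŵ)).hom (r.appTop.hom ((Scheme.ΓSpecIso (.of O)).inv.hom ϖ))) ∈
      nonZeroDivisors (I.subscheme.presheaf.stalk ŵ) := by
    haveI := hflat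
    have hfl := Flat.stalkMap (I.subschemeι ≫ r) ŵ
    set g : ((Spec (.of O)).presheaf.stalk (r (I.subschemeι ŵ)) : Type) →+* (I.subscheme.presheaf.stalk ŵ : Type) :=
      ((I.subschemeι ≫ r).stalkMap ŵ).hom with hg
    have hgfl : g.Flat := hfl
    letI : Algebra ((Spec (.of O)).presheaf.stalk (r (I.subschemeι ŵ)) : Type) (I.subscheme.presheaf.stalk ŵ : Type) := g.toAlgebra
    haveI : Module.Flat ((Spec (.of O)).presheaf.stalk (r (I.subschemeι ŵ)) : Type) (I.subscheme.presheaf.stalk ŵ : Type) := hgfl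
    have hsm := Module.Flat.isSMulRegular_of_nonZeroDivisors (M := (I.subscheme.presheaf.stalk ŵ : Type)) hϖs_reg
    rw [← hcomp]
    refine mem_nonZeroDivisors_iff_right.mpr fun y hy => ?_
    apply hsm
    change ϖs • y = ϖs • (0 : (I.subscheme.presheaf.stalk ŵ : Type))
    rw [smul_zero, Algebra.smul_def, RingHom.algebraMap_toAlgebra, mul_comm]
    exact hy
  -- conclusion in `𝒪_{X,x}`
  intro y hy
  rw [← hψker] at hy ⊢
  have h1 : ψ (_ * y) = 0 := hy
  rw [map_mul, mul_comm] at h1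
  exact (mem_nonZeroDivisors_iff_right.mp hψϖ) _ h1

/-- **THE CENTRE'S 2-FRAMES DESCEND TO THE SPECIAL FIBRE** (DIRDICT (a)'s `hfr` from R2/R3 of `DirLift.Ruled`): in a model square
`j : F ⟶ X` over `θ : O ↠ k`, `O` a DVR, an ideal sheaf `I` with quasi-regular 2-frames at the points of its support, `V(I) → Spec O` flat
and reduced trace `I·𝒪_F = 𝓘⟨Z⟩` has a special fibre `𝓘⟨Z⟩` with quasi-regular 2-frames at every point of `Z` (the images of the
frames). [cite: Matsumura1987, Thm. 16.2] [OURS · L1 W4.5b · S6] toward `stub_elnat_coneTowerPointResolution` /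
`stub_elnat_ratDirZeroPointResolution` (stmt-ResolutionOfSingularities-20148); NOT a statement of the manuscript. -/
theorem forall_exists_twoFrame_specialFibre_of_flat (O : Type) [CommRing O] [IsDomain O] [IsDiscreteValuationRing O]
    (k : Type) [Field k] (θ : O →+* k) (hθ : Function.Surjective θ) {X F : Scheme.{0}} (r : X ⟶ Spec (.of O))
    (j : F ⟶ X) (t : F ⟶ Spec (.of k)) (hsq : IsPullback j t r (Spec.map (CommRingCat.ofHom θ)))
    (I : X.IdealSheafData) (hflat : Flat (I.subschemeι ≫ r))
    (hfr : ∀ x ∈ I.support, ∃ c : Fin 2 → X.presheaf.stalk x, Ideal.span (Set.range c) = stalkIdeal I x ∧ IsQuasiRegular c)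
    {Z : Set F} (hZ : IsClosed Z) (hI : I.comap j = vanishingIdeal (⟨Z, hZ⟩ : Closeds F)) :
    ∀ z ∈ Z, ∃ c : Fin 2 → F.presheaf.stalk z,
      Ideal.span (Set.range c) = stalkIdeal (vanishingIdeal (⟨Z, hZ⟩ : Closeds F)) z ∧ IsQuasiRegular c := by
  intro z hz
  -- `j z ∈ supp I`
  have hjz : j z ∈ I.support := by
    have h : z ∈ ((I.comap j).support : Set F) := by
      rw [hI, Scheme.IdealSheafData.coe_support_vanishingIdeal]; exact hz
    rw [Scheme.IdealSheafData.support_comap, Closeds.coe_preimage] at h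
    exact h
  obtain ⟨c, hc, hqr⟩ := hfr (j z) hjz
  obtain ⟨ϖ, hϖ⟩ := IsDiscreteValuationRing.exists_irreducible O
  refine ⟨fun i => (j.stalkMap z).hom (c i), ?_, ?_⟩
  · rw [← hI, stalkIdeal_comap_eq_map_stalkMap, ← hc, Ideal.map_span, ← Set.range_comp]
    rfl
  · refine IsQuasiRegular.comp_of_surjective hqr
      (a := (X.presheaf.Γgerm (j z)).hom (r.appTop.hom ((Scheme.ΓSpecIso (.of O)).inv.hom ϖ)))
      (fun y hy => ?_) (j.stalkMap z).hom (stalkMap_model_surjective θ hθ r j t hsq z)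
      (stalkMap_model_varpi θ hθ r j t hsq z ϖ (hϖ.maximalIdeal_eq ▸ Ideal.mem_span_singleton_self ϖ))
      (ker_stalkMap_model_le O k θ hθ r j t hsq z ϖ hϖ)
    rw [hc] at hy ⊢
    exact forall_mul_mem_stalkIdeal_of_flat r I hflat (j z) hjz ϖ hϖ.ne_zero y hy

end Summit.ResolutionOfSingularities.ResolutionOfSingularities.Cruxes.EquisingularLiftNat.Sections

end
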